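import Summits.QuantumFields.YangMills.Theorems.LuscherReductionTwistedTraceScalingFloorAssembly
import Summits.QuantumFields.YangMills.Theorems.LuscherReductionTwistedTraceScalingToronZPELipschitz
import HarnessLib

/-!
# The NORMALISATION COMPARISON, part 1: lane B's error budgets when every chart quantity is `O(ρ)`; the Gaussian factor against the ideal one
# (lane A of S-BASE, crux `TwistedTraceScaling` stmt-QuantumFields-20203; design note `pub/ym-fleet/ym-luscher-20007-p1/COARSE-DESIGN.md` §17.7, §19)

After `…FloorAssembly` the valley side of COARSE-UPPER(L) needs, besides `InnerNoIntruderOneOrbitAt`, only the comparison of lane B's explicit UPPER normalisation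
`N_B = riccatiN L β (β^{−r}) (2β^{−q}) (β^{−m}) = riccatiPref · riccatiGauss` (`…ValleyBOUpper`) with the ideal level `Λ_id` (`…FloorAssembly`):
`N_B e^{−6Z₀}/Λ_id = e^{(β/2)(stepErrLo + chartErr)} · e^{trialErr} · (1+ρ²)^{3|E|} · e^{3|E|·modeZPE(μ(1+ρ²)²/2)}`.  At the scales every exponent is a power of `β`:
* §1 helpers: `eventually_const_rpow_le` (`Kβ^{−a} ≤ εβ^{−p}` eventually for `p < a`), `modeZPE_le_sqrt` (`modeZPE y ≤ √y`, via `arsinh x ≤ x`);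
* §2 `trialErr_rho_le` — for `√σ ≤ √2ρ`, `ρ ≤ 1`: `trialErr ≤ (504√N·20√N(L_g√n(10√N)² + m_w)C₁² + m₁C_d(C₁+C₂))·ρ³` (abstract, all atoms variables);
  `stepErr_rho_le` — `(β/2)(stepErrLo + chartErr) ≤ K·βρ³`;
* §3 `riccatiGauss_le` — `riccatiGauss ≤ √(π/β)^{3|E|}·e^{3|E|ρ²}·e^{3|E|√(2μ)}` (`0 ≤ ρ ≤ 1`);
Part 2 (`…FloorNormalisation`): ★★★ `riccatiN_idealCmp_pow` and ★★★★★ `coarseNoIntruderAt_of_inner_pow` (COARSE-UPPER(L) ⇐ INNER one-orbit alone).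
HONEST FRAMING: real asymptotics for a stub lane of a child of the CONDITIONAL reduction route (femto rung R2b1); not infinite volume, not a gap, not Clay.

## References
* M. Lüscher, Nucl. Phys. B219 (1983) 233, §3. [Luscher1983]
* M. Lüscher, G. Münster, Nucl. Phys. B232 (1984) 445, §2. [LuscherMunster1984]
-/

set_option autoImplicit false

noncomputable section

open MeasureTheory Real Finset
open scoped BigOperators
open Literature.MathematicalPhysics.QuantumFieldTheory
open Literature.MathematicalPhysics.QuantumLattice

namespace Summit.QuantumFields.YangMills.Theorems.FemtoTransferGap

open TwoLattice TwoLattice.Toron TwoLattice.Cov TwoLattice.Stiff TwoLattice.Harm TwoLattice.GnChart TwoLattice.Flat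

variable {L : ℕ} [NeZero L]

/-! ## §1 Helpers -/

omit [NeZero L] in
/-- For `p < a`, `ε > 0` and any `K`: eventually `K·β^{−a} ≤ ε·β^{−p}` (and `β ≥ 1`). [folklore] -/
theorem eventually_const_rpow_le {p a K ε : ℝ} (hpa : p < a) (hε : 0 < ε) :
    ∃ β0 : ℝ, ∀ β : ℝ, β0 ≤ β → 1 ≤ β ∧ K * β ^ (-a) ≤ ε * β ^ (-p) := by
  obtain ⟨β0, h⟩ := eventually_rpow_dominates (a := a - p) (b := 0) (k := 0) (C := 4 * (|K| / ε)) (by linarith) (by linarith)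
  refine ⟨β0, fun β hβ => ?_⟩
  obtain ⟨hβ1, h2⟩ := h β hβ
  have hβ0 : 0 < β := lt_of_lt_of_le one_pos hβ1
  refine ⟨hβ1, ?_⟩
  rw [Real.rpow_zero, zero_mul, add_zero] at h2
  have h3 : |K| ≤ ε * β ^ (a - p) := by
    have h6 : |K| / ε ≤ β ^ (a - p) := by linarith only [h2, Real.rpow_nonneg hβ0.le (a - p)]
    rw [div_le_iff₀ hε] at h6
    linarith only [h6]
  have h4 : K * β ^ (-a) ≤ |K| * β ^ (-a) := mul_le_mul_of_nonneg_right (le_abs_self K) (Real.rpow_nonneg hβ0.le _)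
  refine h4.trans ?_
  have h5 : ε * β ^ (a - p) * β ^ (-a) = ε * β ^ (-p) := by
    rw [mul_assoc, ← Real.rpow_add hβ0]; congr 1; congr 1; ring
  rw [← h5]
  exact mul_le_mul_of_nonneg_right h3 (Real.rpow_nonneg hβ0.le _)

omit [NeZero L] in
/-- `modeZPE y ≤ √y` for `y ≥ 0` (`modeZPE y = arsinh √(y/2) ≤ √(y/2)`). [cite: Luscher1983, §3] -/
theorem modeZPE_le_sqrt {y : ℝ} (hy : 0 ≤ y) : modeZPE y ≤ Real.sqrt y := by
  have h1 : modeZPE y = Real.arsinh (Real.sqrt (1 / 2) * Real.sqrt y) := by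
    have := modeZPE_mul_sq_eq_arsinh (κ := 1) zero_le_one (Real.sqrt_nonneg y)
    rwa [Real.sq_sqrt hy, one_mul] at this
  rw [h1]
  have hz : 0 ≤ Real.sqrt (1 / 2) * Real.sqrt y := by positivity
  have h2 : Real.arsinh (Real.sqrt (1 / 2) * Real.sqrt y) ≤ Real.sqrt (1 / 2) * Real.sqrt y := by
    conv_rhs => rw [← Real.arsinh_sinh (Real.sqrt (1 / 2) * Real.sqrt y)]
    exact Real.arsinh_le_arsinh.2 (Real.self_le_sinh_iff.2 hz)
  have h3 : Real.sqrt (1 / 2) ≤ 1 := by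
    rw [show (1 : ℝ) = Real.sqrt 1 from Real.sqrt_one.symm]
    exact Real.sqrt_le_sqrt (by norm_num)
  calc Real.arsinh (Real.sqrt (1 / 2) * Real.sqrt y) ≤ Real.sqrt (1 / 2) * Real.sqrt y := h2
    _ ≤ 1 * Real.sqrt y := mul_le_mul_of_nonneg_right h3 (Real.sqrt_nonneg _)
    _ = Real.sqrt y := one_mul _

/-! ## §2 Lane B's errors when every chart quantity is `O(ρ)` -/

omit [NeZero L] in
/-- ★ **Abstract trial-exponent budget, `ρ`-form**: if `√σ ≤ √2·ρ`, `0 ≤ ρ ≤ 1`, and the weight constants `m_w, m₁, L_g ≥ 0`, then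
`trialErr ρ σ N n m_w m₁ L_g ≤ (504√N·20√N·(L_g√n(10√N)² + m_w)·C₁² + m₁·C_d·(C₁+C₂))·ρ³`, `C₂ = √2 + 10√N`, `C_d = √N(720+66√2) + 5√N`, `C₁ = C₂ + C_d`.
[cite: Luscher1983, §3] -/
theorem trialErr_rho_le {ρ σ N n mw m₁ Lg : ℝ} (hρ0 : 0 ≤ ρ) (hρ1 : ρ ≤ 1) (hsσ : Real.sqrt σ ≤ Real.sqrt 2 * ρ)
    (hmw : 0 ≤ mw) (hm₁ : 0 ≤ m₁) (hLg : 0 ≤ Lg) :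
    trialErr ρ σ N n mw m₁ Lg ≤
      (504 * Real.sqrt N * (20 * Real.sqrt N) * (Lg * Real.sqrt n * (10 * Real.sqrt N) ^ 2 + mw) *
          ((Real.sqrt 2 + 10 * Real.sqrt N) + (Real.sqrt N * (720 + 66 * Real.sqrt 2) + 5 * Real.sqrt N)) ^ 2 +
        m₁ * (Real.sqrt N * (720 + 66 * Real.sqrt 2) + 5 * Real.sqrt N) *
          (((Real.sqrt 2 + 10 * Real.sqrt N) + (Real.sqrt N * (720 + 66 * Real.sqrt 2) + 5 * Real.sqrt N)) + (Real.sqrt 2 + 10 * Real.sqrt N))) * ρ ^ 3 := by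
  have hs0 : 0 ≤ Real.sqrt σ := Real.sqrt_nonneg _
  have hsN : 0 ≤ Real.sqrt N := Real.sqrt_nonneg _
  have hsn : 0 ≤ Real.sqrt n := Real.sqrt_nonneg _
  have hs2 : 0 ≤ Real.sqrt 2 := Real.sqrt_nonneg _
  unfold trialErr stepRem
  generalize hgs : Real.sqrt σ = s at hs0 hsσ ⊢
  generalize hgN : Real.sqrt N = sN at hsN ⊢
  generalize hgn : Real.sqrt n = sn at hsn ⊢
  generalize hg2 : Real.sqrt 2 = s2 at hs2 hsσ ⊢
  -- `A₂ ≤ C₂ ρ`, `r ≤ (720 + 66 s2) ρ²`, `d ≤ C_d ρ²`, `A₁ ≤ C₁ ρ`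
  have hρ2 : ρ ^ 2 ≤ ρ := by
    have := mul_le_mul_of_nonneg_left hρ1 hρ0
    calc ρ ^ 2 = ρ * ρ := by ring
      _ ≤ ρ * 1 := this
      _ = ρ := mul_one ρ
  have hρ3 : ρ ^ 3 ≤ ρ ^ 2 := by
    have := mul_le_mul_of_nonneg_left hρ1 (sq_nonneg ρ)
    calc ρ ^ 3 = ρ ^ 2 * ρ := by ring
      _ ≤ ρ ^ 2 * 1 := this
      _ = ρ ^ 2 := mul_one _
  have hA₂ : s + 10 * ρ * sN ≤ (s2 + 10 * sN) * ρ := by linarith only [hsσ, hsN, hρ0]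
  have hA₂0 : 0 ≤ s + 10 * ρ * sN := by positivity
  have hr : 720 * ρ ^ 2 + 66 * ρ * s ≤ (720 + 66 * s2) * ρ ^ 2 := by
    have := mul_le_mul_of_nonneg_left hsσ (show (0:ℝ) ≤ 66 * ρ by positivity)
    calc 720 * ρ ^ 2 + 66 * ρ * s ≤ 720 * ρ ^ 2 + 66 * ρ * (s2 * ρ) := by linarith only [this]
      _ = (720 + 66 * s2) * ρ ^ 2 := by ring
  have hr0 : 0 ≤ 720 * ρ ^ 2 + 66 * ρ * s := by positivity
  have hd : sN * (720 * ρ ^ 2 + 66 * ρ * s) + 5 * ρ ^ 3 * sN ≤ (sN * (720 + 66 * s2) + 5 * sN) * ρ ^ 2 := by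
    have h1 := mul_le_mul_of_nonneg_left hr hsN
    have h2 := mul_le_mul_of_nonneg_left hρ3 (show (0:ℝ) ≤ 5 * sN by positivity)
    calc sN * (720 * ρ ^ 2 + 66 * ρ * s) + 5 * ρ ^ 3 * sN ≤ sN * ((720 + 66 * s2) * ρ ^ 2) + 5 * sN * ρ ^ 2 := by linarith only [h1, h2]
      _ = _ := by ring
  have hd0 : 0 ≤ sN * (720 * ρ ^ 2 + 66 * ρ * s) + 5 * ρ ^ 3 * sN := by positivity
  have hdρ : sN * (720 * ρ ^ 2 + 66 * ρ * s) + 5 * ρ ^ 3 * sN ≤ (sN * (720 + 66 * s2) + 5 * sN) * ρ :=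
    hd.trans (mul_le_mul_of_nonneg_left hρ2 (by positivity))
  have hA₁ : s + 10 * ρ * sN + (sN * (720 * ρ ^ 2 + 66 * ρ * s) + 5 * ρ ^ 3 * sN) ≤ ((s2 + 10 * sN) + (sN * (720 + 66 * s2) + 5 * sN)) * ρ := by
    linarith only [hA₂, hdρ]
  have hA₁0 : 0 ≤ s + 10 * ρ * sN + (sN * (720 * ρ ^ 2 + 66 * ρ * s) + 5 * ρ ^ 3 * sN) := by positivity
  -- term 1
  have hsq := pow_le_pow_left₀ hA₁0 hA₁ 2
  have h1 : 504 * ρ * sN * (10 * sN + 10 * sN) * (Lg * sn * (10 * sN) ^ 2 + mw) *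
        (s + 10 * ρ * sN + (sN * (720 * ρ ^ 2 + 66 * ρ * s) + 5 * ρ ^ 3 * sN)) ^ 2 ≤
      504 * sN * (20 * sN) * (Lg * sn * (10 * sN) ^ 2 + mw) * ((s2 + 10 * sN) + (sN * (720 + 66 * s2) + 5 * sN)) ^ 2 * ρ ^ 3 := by
    have hpre : 0 ≤ 504 * ρ * sN * (10 * sN + 10 * sN) * (Lg * sn * (10 * sN) ^ 2 + mw) := by positivity
    calc _ ≤ 504 * ρ * sN * (10 * sN + 10 * sN) * (Lg * sn * (10 * sN) ^ 2 + mw) * (((s2 + 10 * sN) + (sN * (720 + 66 * s2) + 5 * sN)) * ρ) ^ 2 :=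
          mul_le_mul_of_nonneg_left hsq hpre
      _ = _ := by ring
  -- term 2
  have h2 : m₁ * (sN * (720 * ρ ^ 2 + 66 * ρ * s) + 5 * ρ ^ 3 * sN) *
        (s + 10 * ρ * sN + (sN * (720 * ρ ^ 2 + 66 * ρ * s) + 5 * ρ ^ 3 * sN) + (s + 10 * ρ * sN)) ≤
      m₁ * (sN * (720 + 66 * s2) + 5 * sN) * (((s2 + 10 * sN) + (sN * (720 + 66 * s2) + 5 * sN)) + (s2 + 10 * sN)) * ρ ^ 3 := by
    have h3 : s + 10 * ρ * sN + (sN * (720 * ρ ^ 2 + 66 * ρ * s) + 5 * ρ ^ 3 * sN) + (s + 10 * ρ * sN) ≤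
        (((s2 + 10 * sN) + (sN * (720 + 66 * s2) + 5 * sN)) + (s2 + 10 * sN)) * ρ := by linarith only [hA₁, hA₂]
    calc _ ≤ m₁ * ((sN * (720 + 66 * s2) + 5 * sN) * ρ ^ 2) * ((((s2 + 10 * sN) + (sN * (720 + 66 * s2) + 5 * sN)) + (s2 + 10 * sN)) * ρ) :=
          mul_le_mul (mul_le_mul_of_nonneg_left hd hm₁) h3 (by positivity) (by positivity)
      _ = _ := by ring
  calc _ ≤ 504 * sN * (20 * sN) * (Lg * sn * (10 * sN) ^ 2 + mw) * ((s2 + 10 * sN) + (sN * (720 + 66 * s2) + 5 * sN)) ^ 2 * ρ ^ 3 +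
        m₁ * (sN * (720 + 66 * s2) + 5 * sN) * (((s2 + 10 * sN) + (sN * (720 + 66 * s2) + 5 * sN)) + (s2 + 10 * sN)) * ρ ^ 3 := add_le_add h1 h2
    _ = _ := by ring

omit [NeZero L] in
/-- ★ `(β/2)(stepErrLo + chartErr) ≤ ((√2+10√N)·√N(720+66√2) + 5√N(√2+10√N))·β·ρ³` when `√σ ≤ √2ρ`, `0 ≤ ρ ≤ 1`, `β ≥ 0`. [cite: Luscher1983, §3] -/
theorem stepErr_rho_le {β ρ σ N : ℝ} (hβ : 0 ≤ β) (hρ0 : 0 ≤ ρ) (hρ1 : ρ ≤ 1) (hsσ : Real.sqrt σ ≤ Real.sqrt 2 * ρ) :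
    β / 2 * (stepErrLo ρ σ N + chartErr ρ σ N) ≤
      ((Real.sqrt 2 + 10 * Real.sqrt N) * (Real.sqrt N * (720 + 66 * Real.sqrt 2)) + 5 * Real.sqrt N * (Real.sqrt 2 + 10 * Real.sqrt N)) * (β * ρ ^ 3) := by
  have hs0 : 0 ≤ Real.sqrt σ := Real.sqrt_nonneg _
  have hsN : 0 ≤ Real.sqrt N := Real.sqrt_nonneg _
  have hs2 : 0 ≤ Real.sqrt 2 := Real.sqrt_nonneg _
  unfold stepErrLo chartErr stepRem
  generalize hgs : Real.sqrt σ = s at hs0 hsσ ⊢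
  generalize hgN : Real.sqrt N = sN at hsN ⊢
  generalize hg2 : Real.sqrt 2 = s2 at hs2 hsσ ⊢
  have hA₂ : s + 10 * ρ * sN ≤ (s2 + 10 * sN) * ρ := by linarith only [hsσ, hsN, hρ0]
  have hA₂0 : 0 ≤ s + 10 * ρ * sN := by positivity
  have hr : 720 * ρ ^ 2 + 66 * ρ * s ≤ (720 + 66 * s2) * ρ ^ 2 := by
    have := mul_le_mul_of_nonneg_left hsσ (show (0:ℝ) ≤ 66 * ρ by positivity)
    calc 720 * ρ ^ 2 + 66 * ρ * s ≤ 720 * ρ ^ 2 + 66 * ρ * (s2 * ρ) := by linarith only [this]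
      _ = (720 + 66 * s2) * ρ ^ 2 := by ring
  have hρ4 : ρ ^ 4 ≤ ρ ^ 3 := by
    have := mul_le_mul_of_nonneg_left hρ1 (pow_nonneg hρ0 3)
    calc ρ ^ 4 = ρ ^ 3 * ρ := by ring
      _ ≤ ρ ^ 3 * 1 := this
      _ = ρ ^ 3 := mul_one _
  have h1 : β / 2 * (2 * (s + 10 * ρ * sN) * (sN * (720 * ρ ^ 2 + 66 * ρ * s))) ≤ (s2 + 10 * sN) * (sN * (720 + 66 * s2)) * (β * ρ ^ 3) := by
    have h3 := mul_le_mul hA₂ (mul_le_mul_of_nonneg_left hr hsN) (by positivity) (by positivity)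
    calc β / 2 * (2 * (s + 10 * ρ * sN) * (sN * (720 * ρ ^ 2 + 66 * ρ * s))) = β * ((s + 10 * ρ * sN) * (sN * (720 * ρ ^ 2 + 66 * ρ * s))) := by ring
      _ ≤ β * ((s2 + 10 * sN) * ρ * (sN * ((720 + 66 * s2) * ρ ^ 2))) := mul_le_mul_of_nonneg_left h3 hβ
      _ = _ := by ring
  have h2 : β / 2 * (10 * ρ ^ 3 * sN * (s + 10 * ρ * sN)) ≤ 5 * sN * (s2 + 10 * sN) * (β * ρ ^ 3) := by
    have h3 : ρ ^ 3 * (s + 10 * ρ * sN) ≤ ρ ^ 3 * ((s2 + 10 * sN) * ρ) := mul_le_mul_of_nonneg_left hA₂ (pow_nonneg hρ0 3)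
    have h4 : ρ ^ 3 * ((s2 + 10 * sN) * ρ) = (s2 + 10 * sN) * ρ ^ 4 := by ring
    rw [h4] at h3
    have h5 : (s2 + 10 * sN) * ρ ^ 4 ≤ (s2 + 10 * sN) * ρ ^ 3 := mul_le_mul_of_nonneg_left hρ4 (by positivity)
    calc β / 2 * (10 * ρ ^ 3 * sN * (s + 10 * ρ * sN)) = 5 * sN * β * (ρ ^ 3 * (s + 10 * ρ * sN)) := by ring
      _ ≤ 5 * sN * β * ((s2 + 10 * sN) * ρ ^ 3) := mul_le_mul_of_nonneg_left (h3.trans h5) (by positivity)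
      _ = _ := by ring
  rw [mul_add]
  calc _ ≤ (s2 + 10 * sN) * (sN * (720 + 66 * s2)) * (β * ρ ^ 3) + 5 * sN * (s2 + 10 * sN) * (β * ρ ^ 3) := add_le_add h1 h2
    _ = _ := by ring

/-! ## §3 Lane B's Gaussian factor against the ideal one -/

/-- ★ `riccatiGauss L β ρ μ ≤ √(π/β)^{3|E|}·e^{3|E|ρ²}·e^{3|E|√(2μ)}` (`β > 0`, `0 ≤ ρ ≤ 1`, `μ ≥ 0`): `√(π/b') = (1+ρ²)√(π/β)`, `1+ρ² ≤ e^{ρ²}`,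
`modeZPE(μ(1+ρ²)²/2) ≤ √(2μ)`. [cite: Wipf2021, §8.5.1] -/
theorem riccatiGauss_le {β ρ μ : ℝ} (hβ : 0 < β) (hρ0 : 0 ≤ ρ) (hρ1 : ρ ≤ 1) (hμ : 0 ≤ μ) :
    riccatiGauss L β ρ μ ≤ Real.sqrt (Real.pi / β) ^ (Fintype.card (Edge 3 L) * 3) *
      Real.exp ((Fintype.card (Edge 3 L) * 3 : ℕ) * ρ ^ 2) * Real.exp ((Fintype.card (Edge 3 L) * 3 : ℕ) * Real.sqrt (2 * μ)) := by
  rw [riccatiGauss]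
  have h1 : Real.sqrt (Real.pi / (β / (1 + ρ ^ 2) ^ 2)) = (1 + ρ ^ 2) * Real.sqrt (Real.pi / β) := by
    have h2 : Real.pi / (β / (1 + ρ ^ 2) ^ 2) = (1 + ρ ^ 2) ^ 2 * (Real.pi / β) := by field_simp
    rw [h2, Real.sqrt_mul' _ (by positivity), Real.sqrt_sq (by positivity)]
  have h3 : 1 + ρ ^ 2 ≤ Real.exp (ρ ^ 2) := by linarith [Real.add_one_le_exp (ρ ^ 2)]
  have h4 : ((1 + ρ ^ 2) * Real.sqrt (Real.pi / β)) ^ (Fintype.card (Edge 3 L) * 3) ≤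
      Real.sqrt (Real.pi / β) ^ (Fintype.card (Edge 3 L) * 3) * Real.exp ((Fintype.card (Edge 3 L) * 3 : ℕ) * ρ ^ 2) := by
    rw [mul_pow, Real.exp_nat_mul, mul_comm]
    exact mul_le_mul_of_nonneg_left (pow_le_pow_left₀ (by positivity) h3 _) (by positivity)
  have h5 : modeZPE (β / 2 * μ / (β / (1 + ρ ^ 2) ^ 2)) ≤ Real.sqrt (2 * μ) := by
    have h6 : β / 2 * μ / (β / (1 + ρ ^ 2) ^ 2) = μ * (1 + ρ ^ 2) ^ 2 / 2 := by field_simp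
    rw [h6]
    refine (modeZPE_le_sqrt (by positivity)).trans (Real.sqrt_le_sqrt ?_)
    have hρ2 : ρ ^ 2 ≤ 1 := by
      have := mul_le_mul hρ1 hρ1 hρ0 zero_le_one
      calc ρ ^ 2 = ρ * ρ := by ring
        _ ≤ 1 * 1 := this
        _ = 1 := by ring
    have h7 : (1 + ρ ^ 2) ^ 2 ≤ 4 := by
      have h8 : 1 + ρ ^ 2 ≤ 2 := by linarith only [hρ2]
      have := mul_le_mul h8 h8 (by positivity) (by norm_num)
      calc (1 + ρ ^ 2) ^ 2 = (1 + ρ ^ 2) * (1 + ρ ^ 2) := by ring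
        _ ≤ 2 * 2 := this
        _ = 4 := by norm_num
    have := mul_le_mul_of_nonneg_left h7 hμ
    linarith only [this]
  have h8 : Real.exp ((Fintype.card (Edge 3 L) * 3 : ℕ) * modeZPE (β / 2 * μ / (β / (1 + ρ ^ 2) ^ 2))) ≤
      Real.exp ((Fintype.card (Edge 3 L) * 3 : ℕ) * Real.sqrt (2 * μ)) :=
    Real.exp_le_exp.2 (mul_le_mul_of_nonneg_left h5 (Nat.cast_nonneg _))
  rw [h1]
  exact mul_le_mul h4 h8 (Real.exp_pos _).le (by positivity)

end Summit.QuantumFields.YangMills.Theorems.FemtoTransferGap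

end
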